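import Summits.NavierStokesRegularity.NavierStokesRegularity.Theorems.QuarterLogPincerLogCubeSharpPhiEnergy
import Summits.NavierStokesRegularity.NavierStokesRegularity.Theorems.QuarterLogPincerLogCubeSharpLFour
import HarnessLib

/-!
# `QuarterLogPincer.LogCubeSharp` (item stmt-NavierStokesRegularity-23935): assembly lemmas

Helper file (`--supports stmt-NavierStokesRegularity-23935`) of the crux `LogCubeSharp` of route
`QuarterLogPincer`. The closing file `QuarterLogPincerLogCubeSharp.lean` runs the regularised `L³`
energy inequality (`…PhiEnergy.lean`) on the Tao-class cover of each sub-slab `[0,t]`; this file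
holds the solution-free bookkeeping it needs:

* `isClassicalNSSolutionOn_sub_const` — shifting the pressure by a constant keeps a classical
  solution classical (`∇(p − C) = ∇p`): used to renormalise the frame pressure to its Riesz
  pressure `p(τ) − C(τ) ∈ L²` (Tao 2013, Lemma 4.1);
* `memLp_gradient_pressure` — `∇p(τ) ∈ L²` from the momentum equation
  `∇p = νΔu − (u·∇)u − ∂ₜu` for a bounded slice with `D²u, Du, ∂ₜu ∈ L²`;
* `integral_Ioo_rpow_neg_threeQuarters_le`, `integral_Ioo_inv_sub_eq_log`, `integrableOn_majorant`,
  `integral_majorant_le` — the time integrals `∫₀ᵗ(T−τ)^{-3/4} ≤ 4T^{1/4}`,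
  `∫₀ᵗ(T−τ)⁻¹ = log(T/(T−t))` of the majorant `A₁(T−τ)^{-3/4} + A₂(T−τ)⁻¹`;
* `eLpNorm_three_pow_three`, `eLpNorm_three_pow_three_le_ofReal_integral` — the currency
  `‖f‖₃³ = ∫‖f‖³ ≤ ∫ g` for a pointwise majorant `g` (here `g = Φ(u)`);
* `exists_global_typeI` — the eventual velocity Type-I rate `‖u(t)‖_∞ ≤ C/√(T−t)` (`t ↑ T`) plus
  boundedness on early closed sub-slabs gives `‖u(t,x)‖ ≤ C'/√(T−t)` on ALL of `[0,T)`.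

HONEST FRAMING: bookkeeping; the crux is NOT closed by this file and Navier–Stokes regularity is
NOT proved here, nor claimed. [folklore]
-/

noncomputable section

open MeasureTheory TopologicalSpace Set Function Filter Topology InnerProductSpace
open Literature.Analysis Literature.Analysis.FluidPDE
open scoped RealInnerProductSpace ENNReal NNReal Laplacian

namespace Summit.NavierStokesRegularity.NavierStokesRegularity.Theorems

set_option linter.dupNamespace false

namespace LogCubeSharp


/-! ### Shifting the pressure by a constant -/

section PressureShift

variable {E : Type*} [NormedAddCommGroup E] [InnerProductSpace ℝ E] [FiniteDimensional ℝ E]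

/-- **Shifting the pressure by a constant** keeps a classical solution classical (the pressure
enters through `∇p` only). [folklore] -/
theorem isClassicalNSSolutionOn_sub_const {S : Set ℝ} {ν : ℝ} {f u : ℝ → E → E} {p : ℝ → E → ℝ}
    (h : IsClassicalNSSolutionOn S ν f u p) (C : ℝ) :
    IsClassicalNSSolutionOn S ν f u (fun t x => p t x - C) where
  smooth_velocity := h.smooth_velocity
  smooth_pressure := h.smooth_pressure.sub (isSmoothSpaceTimeOn_const_time contDiff_const S)
  momentum t ht x := by
    have hm := h.momentum t ht x
    rwa [← gradient_sub_const (p t) C x] at hm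
  divFree := h.divFree

end PressureShift

/-! ### The pressure gradient of a classical solution with `L²` data is in `L²` -/

section GradientPressure

variable {E : Type*} [NormedAddCommGroup E] [InnerProductSpace ℝ E] [FiniteDimensional ℝ E]
  [MeasurableSpace E] [BorelSpace E]

/-- **`∇p(τ) ∈ L²` from the momentum equation** `∇p = νΔu − (u·∇)u − ∂ₜu` (unforced), for a
bounded slice with `D²u(τ), Du(τ), ∂ₜu(τ) ∈ L²`. [folklore] -/
theorem memLp_gradient_pressure {S : Set ℝ} {ν : ℝ} {u : ℝ → E → E} {p : ℝ → E → ℝ}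
    (hcl : IsClassicalNSSolutionOn S ν 0 u p) {τ : ℝ} (hτ : τ ∈ S) {M : ℝ}
    (hM : ∀ x, ‖u τ x‖ ≤ M) (hDu : MemLp (fun x => fderiv ℝ (u τ) x) 2 volume)
    (hD2u : MemLp (fun x => iteratedFDeriv ℝ 2 (u τ) x) 2 volume)
    (hut : MemLp (fun x => timeDerivWithin S u τ x) 2 volume) :
    MemLp (fun x => gradient (p τ) x) 2 volume := by
  have hM0 : 0 ≤ M := (norm_nonneg _).trans (hM 0)
  have hu2 : ContDiff ℝ 2 (u τ) := (hcl.contDiff_velocity hτ).of_le (by norm_cast)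
  have hu1 : ContDiff ℝ 1 (u τ) := (hcl.contDiff_velocity hτ).of_le (by norm_cast)
  have huc : Continuous (u τ) := hu1.continuous
  have hDuc : Continuous fun x => fderiv ℝ (u τ) x := hu1.continuous_fderiv one_ne_zero
  have hmom : ∀ x, gradient (p τ) x =
      ν • (Δ (u τ)) x - fderiv ℝ (u τ) x (u τ x) - timeDerivWithin S u τ x := by
    intro x
    have h := hcl.momentum τ hτ x
    simp only [convect_apply, Pi.zero_apply, add_zero] at h
    have h' : gradient (p τ) x =
        ν • (Δ (u τ)) x - (timeDerivWithin S u τ x + fderiv ℝ (u τ) x (u τ x)) := by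
      rw [h]; abel
    rw [h']; abel
  have hLap : MemLp (fun x => (Δ (u τ)) x) 2 volume :=
    hD2u.of_le_mul (continuous_laplacian hu2).aestronglyMeasurable
      (Eventually.of_forall fun x => norm_laplacian_le hu2 x)
  have hconv : MemLp (fun x => fderiv ℝ (u τ) x (u τ x)) 2 volume :=
    hDu.of_le_mul (c := M) (hDuc.clm_apply huc).aestronglyMeasurable
      (Eventually.of_forall fun x => by
        calc ‖fderiv ℝ (u τ) x (u τ x)‖ ≤ ‖fderiv ℝ (u τ) x‖ * ‖u τ x‖ :=
              ContinuousLinearMap.le_opNorm _ _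
          _ ≤ ‖fderiv ℝ (u τ) x‖ * M := by gcongr; exact hM x
          _ = M * ‖fderiv ℝ (u τ) x‖ := mul_comm _ _)
  have h := ((hLap.const_smul ν).sub hconv).sub hut
  refine h.congr_norm ?_ (Eventually.of_forall fun x => ?_)
  · exact ((InnerProductSpace.toDual ℝ E).symm.continuous.comp
      ((hcl.contDiff_pressure hτ).continuous_fderiv (by norm_cast))).aestronglyMeasurable
  · simp only [Pi.sub_apply, Pi.smul_apply, hmom x]

end GradientPressure

/-! ### The two time integrals of the assembly -/

section TimeIntegrals

/-- `∫_{(0,t)} (T−τ)^{-3/4} dτ ≤ 4 T^{1/4}` for `0 < t < T`. [folklore] -/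
theorem integral_Ioo_rpow_neg_threeQuarters_le {t T : ℝ} (ht : 0 < t) (htT : t < T) :
    ∫ τ in Ioo 0 t, (T - τ) ^ (-(3 / 4 : ℝ)) ≤ 4 * T ^ (1 / 4 : ℝ) := by
  have hT : 0 < T := ht.trans htT
  have hTt : 0 < T - t := sub_pos.2 htT
  rw [← integral_Ioc_eq_integral_Ioo, ← intervalIntegral.integral_of_le ht.le,
    intervalIntegral.integral_comp_sub_left (fun x : ℝ => x ^ (-(3 / 4 : ℝ))) T, sub_zero,
    integral_rpow (Or.inl (by norm_num))]
  have e : (-(3 / 4 : ℝ) + 1) = 1 / 4 := by norm_num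
  rw [e]
  have h1 : 0 ≤ (T - t) ^ (1 / 4 : ℝ) := Real.rpow_nonneg hTt.le _
  have h2 : 0 ≤ T ^ (1 / 4 : ℝ) := Real.rpow_nonneg hT.le _
  rw [div_le_iff₀ (by norm_num : (0:ℝ) < 1 / 4)]
  nlinarith

/-- `∫_{(0,t)} (T−τ)⁻¹ dτ = log(T/(T−t))` for `0 < t < T`. [folklore] -/
theorem integral_Ioo_inv_sub_eq_log {t T : ℝ} (ht : 0 < t) (htT : t < T) :
    ∫ τ in Ioo 0 t, (T - τ)⁻¹ = Real.log (T / (T - t)) := by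
  have hT : 0 < T := ht.trans htT
  have hTt : 0 < T - t := sub_pos.2 htT
  rw [← integral_Ioc_eq_integral_Ioo, ← intervalIntegral.integral_of_le ht.le,
    intervalIntegral.integral_comp_sub_left (fun x : ℝ => x⁻¹) T, sub_zero,
    integral_inv_of_pos hTt hT]

/-- The majorant `A₁ (T−τ)^{-3/4} + A₂ (T−τ)⁻¹` is integrable on `(0,t)`, `t < T`. [folklore] -/
theorem integrableOn_majorant {t T A₁ A₂ : ℝ} (htT : t < T) :
    IntegrableOn (fun τ : ℝ => A₁ * (T - τ) ^ (-(3 / 4 : ℝ)) + A₂ * (T - τ)⁻¹) (Ioo 0 t) volume := by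
  have hc : ContinuousOn (fun τ : ℝ => A₁ * (T - τ) ^ (-(3 / 4 : ℝ)) + A₂ * (T - τ)⁻¹) (Icc 0 t) := by
    refine (continuousOn_const.mul ?_).add (continuousOn_const.mul ?_)
    · exact ContinuousOn.rpow_const (continuous_const.sub continuous_id).continuousOn
        fun τ hτ => Or.inl (show (T - τ : ℝ) ≠ 0 by have := hτ.2; linarith)
    · exact ContinuousOn.inv₀ (continuous_const.sub continuous_id).continuousOn
        fun τ hτ => show (T - τ : ℝ) ≠ 0 by have := hτ.2; linarith
  exact (hc.integrableOn_Icc).mono_set Ioo_subset_Icc_self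

/-- The integral of the majorant: `∫_{(0,t)} (A₁ (T−τ)^{-3/4} + A₂ (T−τ)⁻¹) ≤ 4A₁T^{1/4} + A₂ log(T/(T−t))`
for `A₁ ≥ 0`. [folklore] -/
theorem integral_majorant_le {t T A₁ A₂ : ℝ} (ht : 0 < t) (htT : t < T) (hA₁ : 0 ≤ A₁) :
    (∫ τ in Ioo 0 t, (A₁ * (T - τ) ^ (-(3 / 4 : ℝ)) + A₂ * (T - τ)⁻¹)) ≤
      4 * A₁ * T ^ (1 / 4 : ℝ) + A₂ * Real.log (T / (T - t)) := by
  have hTt : 0 < T - t := sub_pos.2 htT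
  have hi1 : IntegrableOn (fun τ : ℝ => (T - τ) ^ (-(3 / 4 : ℝ))) (Ioo 0 t) volume := by
    have h := integrableOn_majorant (A₁ := 1) (A₂ := 0) htT
    refine h.congr_fun (fun τ _ => by simp) measurableSet_Ioo
  have hi2 : IntegrableOn (fun τ : ℝ => (T - τ)⁻¹) (Ioo 0 t) volume := by
    have h := integrableOn_majorant (A₁ := 0) (A₂ := 1) htT
    refine h.congr_fun (fun τ _ => by simp) measurableSet_Ioo
  rw [integral_add (hi1.const_mul A₁) (hi2.const_mul A₂), integral_const_mul, integral_const_mul,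
    integral_Ioo_inv_sub_eq_log ht htT]
  have h1 := integral_Ioo_rpow_neg_threeQuarters_le ht htT
  nlinarith

end TimeIntegrals

/-! ### Currency: `‖f‖₃³` as an integral, the global Type-I majorant -/

section Currency

variable {E : Type*} [NormedAddCommGroup E] [InnerProductSpace ℝ E] [FiniteDimensional ℝ E]
  [MeasurableSpace E] [BorelSpace E]

/-- `‖f‖_{L³}³ = ∫⁻ ‖f‖ₑ³`. [folklore] -/
theorem eLpNorm_three_pow_three {F : Type*} [NormedAddCommGroup F] (f : E → F) :
    eLpNorm f 3 volume ^ (3 : ℕ) = ∫⁻ x, ‖f x‖ₑ ^ (3 : ℕ) := by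
  have h := eLpNorm_nnreal_pow_eq_lintegral (f := f) (μ := volume) (p := (3 : ℝ≥0)) (by norm_num)
  simp only [ENNReal.coe_ofNat, NNReal.coe_ofNat] at h
  have e1 : eLpNorm f 3 volume ^ (3 : ℕ) = eLpNorm f 3 volume ^ (3 : ℝ) := by
    rw [← ENNReal.rpow_natCast]; norm_num
  rw [e1, h]
  refine lintegral_congr fun x => ?_
  rw [← ENNReal.rpow_natCast]; norm_num

/-- `‖f‖_{L³}³ ≤ ofReal (∫ g)` when `‖f‖³ ≤ g` pointwise with `g` integrable. [folklore] -/
theorem eLpNorm_three_pow_three_le_ofReal_integral {F : Type*} [NormedAddCommGroup F] {f : E → F}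
    {g : E → ℝ} (hg : Integrable g volume) (hfg : ∀ x, ‖f x‖ ^ 3 ≤ g x) :
    eLpNorm f 3 volume ^ (3 : ℕ) ≤ ENNReal.ofReal (∫ x, g x) := by
  rw [eLpNorm_three_pow_three]
  have hg0 : ∀ x, 0 ≤ g x := fun x => (pow_nonneg (norm_nonneg _) 3).trans (hfg x)
  rw [ofReal_integral_eq_lintegral_ofReal hg (Eventually.of_forall hg0)]
  refine lintegral_mono fun x => ?_
  rw [← ofReal_norm, ← ENNReal.ofReal_pow (norm_nonneg _)]
  exact ENNReal.ofReal_le_ofReal (hfg x)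

end Currency

section TypeI

variable {E : Type*} [NormedAddCommGroup E]

/-- **The velocity Type-I rate holds on the whole of `[0,T)` with a worse constant**: if
`‖u(t)‖_∞ ≤ C/√(T−t)` eventually as `t ↑ T` and `u` is bounded by `B` on `[0, t₁]` for every
`t₁ < T`-cover supplied, then `‖u(t,x)‖ ≤ C'/√(T−t)` for all `t ∈ [0,T)`. Here the bound on the
early times is a hypothesis (`hB`). [folklore] -/
theorem exists_global_typeI {T : ℝ} (hT : 0 < T) {u : ℝ → E → E}
    (hI : ∃ C : ℝ, ∀ᶠ t in 𝓝[<] T, ∀ x, ‖u t x‖ ≤ C / Real.sqrt (T - t))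
    (hB : ∀ t₁ ∈ Ioo 0 T, ∃ B : ℝ, ∀ t ∈ Icc 0 t₁, ∀ x, ‖u t x‖ ≤ B) :
    ∃ C' : ℝ, 0 ≤ C' ∧ ∀ t ∈ Ico 0 T, ∀ x, ‖u t x‖ ≤ C' / Real.sqrt (T - t) := by
  obtain ⟨C, hC⟩ := hI
  obtain ⟨l, hlT, hl⟩ := mem_nhdsLT_iff_exists_Ioo_subset.1 hC
  set t₁ : ℝ := max l (T / 2) with ht₁
  have ht₁I : t₁ ∈ Ioo 0 T := ⟨lt_max_of_lt_right (by positivity), max_lt hlT (by linarith)⟩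
  obtain ⟨B, hBb⟩ := hB t₁ ht₁I
  have hB0 : 0 ≤ B := (norm_nonneg _).trans (hBb 0 ⟨le_rfl, ht₁I.1.le⟩ 0)
  refine ⟨max C 0 + B * Real.sqrt T, by positivity, fun t ht x => ?_⟩
  have hTt : 0 < T - t := sub_pos.2 ht.2
  have hsq : 0 < Real.sqrt (T - t) := Real.sqrt_pos.2 hTt
  have hsqle : Real.sqrt (T - t) ≤ Real.sqrt T := Real.sqrt_le_sqrt (by linarith [ht.1])
  rw [le_div_iff₀ hsq]
  rcases le_or_gt t t₁ with h | h
  · -- early times: the cover bound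
    have h1 := hBb t ⟨ht.1, h⟩ x
    have h2 : ‖u t x‖ * Real.sqrt (T - t) ≤ B * Real.sqrt T :=
      mul_le_mul h1 hsqle hsq.le hB0
    nlinarith [le_max_right C 0]
  · -- late times: the Type-I rate
    have htl : t ∈ Ioo l T := ⟨(le_max_left _ _).trans_lt h, ht.2⟩
    have h1 : ‖u t x‖ ≤ C / Real.sqrt (T - t) := hl htl x
    rw [div_eq_mul_inv] at h1
    have h2 : ‖u t x‖ * Real.sqrt (T - t) ≤ C := by
      have := mul_le_mul_of_nonneg_right h1 hsq.le
      rwa [mul_assoc, inv_mul_cancel₀ hsq.ne', mul_one] at this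
    nlinarith [le_max_left C 0, Real.sqrt_nonneg T]

end TypeI

end LogCubeSharp

end Summit.NavierStokesRegularity.NavierStokesRegularity.Theorems

end
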